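import Literature.NumberTheory.EllipticCurves.SzpiroFreyProofs
import Literature.NumberTheory.DiophantineGeometry.ConductorExponentLeTwoProofs

/-!
# Twisted Frey covariants: minimality and conductor of any integral model with
`c₄ = 16 d² (A²+AB+B²)`, `Δ = 16 d⁶ (AB(A+B))²`

Support file for the negative side (cdisprove) of crux `TwistAmplification.SomeWindowSaving`
(stmt-ABC-1976).  For `A, B` coprime, `16 ∤ AB(A+B)`, and a prime `d ≥ 5` with `d ∤ AB(A+B)`
(the quadratic twist by `d` of the Frey curve of `(A, B)`): global minimality at every place
(`v_d(Δ) = 6 < 12`), `N ∣ 2¹⁰ · rad(AB(A+B)) · d²` (tame bound `f_d ≤ 2` of the tree,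
`conductorExponent_le_two_of_five_le_natGenerator_holds`), odd multiplicative primes divide `N`,
and `d² ∣ N` (additive reduction at `d`, `two_le_conductorExponent_of_dvd_Δ_of_dvd_c₄`).
No modularity input.
-/

noncomputable section

open UniqueFactorizationMonoid IsDedekindDomain Real WeierstrassCurve Rat.HeightOneSpectrum
open Literature.NumberTheory.EllipticCurves

namespace Summit.ABC.ABC.Theorems.SomeWindowSaving.Negative

section TwistLike

variable {A B : ℤ} {d : ℕ} {W₀ : WeierstrassCurve ℤ}

/-- A model with the twisted Frey covariants is an elliptic curve. -/
theorem isElliptic_of_twistCovariants (h0 : A * B * (A + B) ≠ 0) (hd : d.Prime)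
    (hΔ : W₀.Δ = 16 * (d : ℤ) ^ 6 * (A * B * (A + B)) ^ 2) : (W₀.baseChange ℚ).IsElliptic := by
  refine ⟨?_⟩
  rw [baseChange_int_Δ, hΔ, isUnit_iff_ne_zero]
  have hd0 : (d : ℤ) ≠ 0 := by exact_mod_cast hd.ne_zero
  have h : (16 : ℤ) * (d : ℤ) ^ 6 * (A * B * (A + B)) ^ 2 ≠ 0 :=
    mul_ne_zero (mul_ne_zero (by norm_num) (pow_ne_zero 6 hd0)) (pow_ne_zero 2 h0)
  exact_mod_cast h

/-- `2¹² ∤`, `d`-coprimality helper: `IsCoprime (2^12) (d^6)` for an odd prime `d`. -/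
theorem isCoprime_two_pow_of_prime (hd : d.Prime) (hd2 : d ≠ 2) :
    IsCoprime ((2 : ℤ) ^ 12) ((d : ℤ) ^ 6) := by
  have h : Nat.Coprime 2 d := (Nat.coprime_primes Nat.prime_two hd).mpr (Ne.symm hd2)
  have h' : IsCoprime ((2 : ℕ) : ℤ) (d : ℤ) := Nat.isCoprime_iff_coprime.mpr h
  exact IsCoprime.pow (by simpa using h')

/-- Global minimality of any integral model with the twisted Frey covariants
(`A, B` coprime, `16 ∤ AB(A+B)`, `d ≥ 5` prime, `d ∤ AB(A+B)`). -/
theorem isMinimalAt_of_twistCovariants (hAB : IsCoprime A B) (h0 : A * B * (A + B) ≠ 0)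
    (h16 : ¬ (16 : ℤ) ∣ A * B * (A + B)) (hd : d.Prime) (hd5 : 5 ≤ d)
    (hdM : ¬ (d : ℤ) ∣ A * B * (A + B))
    (hc₄ : W₀.c₄ = 16 * (d : ℤ) ^ 2 * (A ^ 2 + A * B + B ^ 2))
    (hΔ : W₀.Δ = 16 * (d : ℤ) ^ 6 * (A * B * (A + B)) ^ 2)
    (v : HeightOneSpectrum ℤ) : (W₀.baseChange ℚ).IsMinimalAt v := by
  set p := natGenerator v with hp
  have hpp : p.Prime := prime_natGenerator v
  have hpint : Prime (p : ℤ) := Nat.prime_iff_prime_int.mp hpp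
  have hdint : Prime (d : ℤ) := Nat.prime_iff_prime_int.mp hd
  have hd2 : d ≠ 2 := by omega
  have hcop := isCoprime_two_pow_of_prime hd hd2
  have hre : (16 : ℤ) * (d : ℤ) ^ 6 * (A * B * (A + B)) ^ 2 =
      (d : ℤ) ^ 6 * (16 * (A * B * (A + B)) ^ 2) := by ring
  by_cases hpm : (p : ℤ) ∣ A * B * (A + B)
  · by_cases h2 : p = 2
    · refine isMinimalAt_baseChange_int_of_not_pow_dvd_Δ ?_
      rw [← hp, h2, hΔ, hre]
      intro h
      have h' : (2 : ℤ) ^ 12 ∣ (d : ℤ) ^ 6 * (16 * (A * B * (A + B)) ^ 2) := by exact_mod_cast h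
      have h'' := hcop.dvd_of_dvd_mul_left h'
      exact not_two_pow_eleven_dvd h0 h16 (dvd_trans (pow_dvd_pow 2 (by norm_num : 11 ≤ 12)) h'')
    · refine isMinimalAt_baseChange_int_of_not_dvd_c₄ ?_
      rw [← hp, hc₄]
      intro h
      rcases hpint.dvd_or_dvd h with h | h
      · rcases hpint.dvd_or_dvd h with h | h
        · exact h2 (eq_two_of_dvd_sixteen hpp h)
        · have hpd : (p : ℤ) ∣ d := hpint.dvd_of_dvd_pow h
          have : p = d := (Nat.prime_dvd_prime_iff_eq hpp hd).mp (Int.natCast_dvd_natCast.mp hpd)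
          exact hdM (this ▸ hpm)
      · exact not_dvd_sq_add_mul_add_sq hAB hpp hpm h
  · refine isMinimalAt_baseChange_int_of_not_pow_dvd_Δ ?_
    rw [← hp, hΔ]
    intro h
    have h1 : (p : ℤ) ∣ 16 * (d : ℤ) ^ 6 * (A * B * (A + B)) ^ 2 :=
      dvd_trans (dvd_pow_self _ (by norm_num)) h
    rcases hpint.dvd_or_dvd h1 with h1 | h1
    · rcases hpint.dvd_or_dvd h1 with h1 | h1
      · have hp2 : p = 2 := eq_two_of_dvd_sixteen hpp h1
        apply hpm
        rw [hp2] at h ⊢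
        rw [hre] at h
        have h' : (2 : ℤ) ^ 12 ∣ (d : ℤ) ^ 6 * (16 * (A * B * (A + B)) ^ 2) := by exact_mod_cast h
        have h'' : (2 : ℤ) ^ 12 ∣ 16 * (A * B * (A + B)) ^ 2 := hcop.dvd_of_dvd_mul_left h'
        have h3 : (2 : ℤ) ^ 8 ∣ (A * B * (A + B)) ^ 2 := by
          have e : (2 : ℤ) ^ 12 = 16 * 2 ^ 8 := by norm_num
          rw [e] at h''
          exact (mul_dvd_mul_iff_left (by norm_num : (16 : ℤ) ≠ 0)).mp h''
        exact_mod_cast Int.prime_two.dvd_of_dvd_pow (dvd_trans (dvd_pow_self 2 (by norm_num)) h3)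
      · have hpd : (p : ℤ) ∣ d := hpint.dvd_of_dvd_pow h1
        have hpd' : p = d := (Nat.prime_dvd_prime_iff_eq hpp hd).mp (Int.natCast_dvd_natCast.mp hpd)
        rw [hpd', hre] at h
        have e1 : ((d : ℕ) : ℤ) ^ 12 = (d : ℤ) ^ 6 * (d : ℤ) ^ 6 := by ring
        rw [e1] at h
        have hd0 : (d : ℤ) ^ 6 ≠ 0 := pow_ne_zero _ (by exact_mod_cast hd.ne_zero)
        have h'' : (d : ℤ) ^ 6 ∣ 16 * (A * B * (A + B)) ^ 2 := (mul_dvd_mul_iff_left hd0).mp h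
        have h3 : (d : ℤ) ∣ 16 * (A * B * (A + B)) ^ 2 := dvd_trans (dvd_pow_self _ (by norm_num)) h''
        rcases hdint.dvd_or_dvd h3 with h3 | h3
        · exact hd2 (eq_two_of_dvd_sixteen hd h3)
        · exact hdM (hdint.dvd_of_dvd_pow h3)
    · exact hpm (hpint.dvd_of_dvd_pow h1)

/-- Conductor of a twisted Frey model: `N ∣ 2¹⁰ · rad(AB(A+B)) · d²` (`f_d ≤ 2` by tameness at
`d ≥ 5`; `f_q = 1` at odd `q ∣ AB(A+B)`; `f₂ ≤ 10`). -/
theorem conductorNorm_dvd_of_twistCovariants (hAB : IsCoprime A B) (h0 : A * B * (A + B) ≠ 0)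
    (h16 : ¬ (16 : ℤ) ∣ A * B * (A + B)) (hd : d.Prime) (hd5 : 5 ≤ d)
    (hdM : ¬ (d : ℤ) ∣ A * B * (A + B))
    (hc₄ : W₀.c₄ = 16 * (d : ℤ) ^ 2 * (A ^ 2 + A * B + B ^ 2))
    (hΔ : W₀.Δ = 16 * (d : ℤ) ^ 6 * (A * B * (A + B)) ^ 2) :
    (W₀.baseChange ℚ).conductorNorm ℤ ∣ 2 ^ 10 * radical (A * B * (A + B)).natAbs * d ^ 2 := by
  haveI := isElliptic_of_twistCovariants h0 hd hΔ
  set m := A * B * (A + B) with hm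
  have hm0 : m.natAbs ≠ 0 := Int.natAbs_ne_zero.mpr h0
  have hd2 : d ≠ 2 := by omega
  have hdint : Prime (d : ℤ) := Nat.prime_iff_prime_int.mp hd
  have hcop := isCoprime_two_pow_of_prime hd hd2
  have hre : (16 : ℤ) * (d : ℤ) ^ 6 * m ^ 2 = (d : ℤ) ^ 6 * (16 * m ^ 2) := by ring
  refine conductorNorm_dvd_of_forall_conductorExponent_le _
    (mul_ne_zero (mul_ne_zero (by positivity) radical_ne_zero) (pow_ne_zero 2 hd.ne_zero)) fun q ↦ ?_
  obtain ⟨v, hv⟩ := exists_place q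
  obtain ⟨q, hq⟩ := q
  simp only at hv ⊢
  have hmin := isMinimalAt_of_twistCovariants hAB h0 h16 hd hd5 hdM hc₄ hΔ v
  have hqint : Prime (q : ℤ) := Nat.prime_iff_prime_int.mp hq
  have hfd : (d ^ 2).factorization q = if d = q then 2 else 0 := by
    rw [Nat.factorization_pow, Finsupp.smul_apply, hd.factorization, Finsupp.single_apply]
    split_ifs <;> simp
  rw [show (primesEquiv (R := ℤ)).symm ⟨q, hq⟩ = v from
      (primesEquiv (R := ℤ)).symm_apply_eq.mpr (Subtype.ext hv.symm),
    Nat.factorization_mul (mul_ne_zero (by positivity) radical_ne_zero) (pow_ne_zero 2 hd.ne_zero),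
    Nat.factorization_mul (by positivity) radical_ne_zero, Finsupp.add_apply, Finsupp.add_apply,
    Literature.NumberTheory.DiophantineGeometry.factorization_radical_apply hm0 hq,
    Nat.Prime.factorization_pow Nat.prime_two, Finsupp.single_apply, hfd]
  by_cases h2 : q = 2
  · subst h2
    have : (W₀.baseChange ℚ).conductorExponent v < 11 := by
      refine conductorExponent_lt_of_not_pow_dvd hmin ?_
      rw [hv, hΔ, hre]
      intro h
      have h' : (2 : ℤ) ^ 11 ∣ (d : ℤ) ^ 6 * (16 * m ^ 2) := by exact_mod_cast h
      have hcop' : IsCoprime ((2 : ℤ) ^ 11) ((d : ℤ) ^ 6) := by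
        have h : Nat.Coprime 2 d := (Nat.coprime_primes Nat.prime_two hd).mpr (Ne.symm hd2)
        have h'' : IsCoprime ((2 : ℕ) : ℤ) (d : ℤ) := Nat.isCoprime_iff_coprime.mpr h
        exact IsCoprime.pow (by simpa using h'')
      exact not_two_pow_eleven_dvd h0 h16 (hcop'.dvd_of_dvd_mul_left h')
    rw [if_pos rfl]
    split_ifs <;> omega
  rw [if_neg (Ne.symm h2), zero_add]
  by_cases hqd : d = q
  · subst hqd
    rw [if_pos rfl]
    have : (W₀.baseChange ℚ).conductorExponent v ≤ 2 :=
      conductorExponent_le_two_of_five_le_natGenerator_holds (W₀.baseChange ℚ) v (by rw [hv]; exact hd5)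
    split_ifs <;> omega
  rw [if_neg hqd]
  by_cases hqm : (q : ℤ) ∣ m
  · rw [if_pos (Int.natCast_dvd.mp hqm)]
    refine (conductorExponent_eq_one_of_dvd_Δ_of_not_dvd_c₄ hmin ?_ ?_).le
    · rw [hv, hΔ]
      exact dvd_mul_of_dvd_right (dvd_pow hqm two_ne_zero) _
    · rw [hv, hc₄]
      intro h
      rcases hqint.dvd_or_dvd h with h | h
      · rcases hqint.dvd_or_dvd h with h | h
        · exact h2 (eq_two_of_dvd_sixteen hq h)
        · have hqd' : (q : ℤ) ∣ d := hqint.dvd_of_dvd_pow h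
          exact hqd ((Nat.prime_dvd_prime_iff_eq hq hd).mp (Int.natCast_dvd_natCast.mp hqd')).symm
      · exact not_dvd_sq_add_mul_add_sq hAB hq hqm h
  · rw [if_neg (mt Int.natCast_dvd.mpr hqm)]
    refine (conductorExponent_eq_zero_of_not_dvd_Δ hmin ?_).le
    rw [hv, hΔ]
    intro h
    rcases hqint.dvd_or_dvd h with h | h
    · rcases hqint.dvd_or_dvd h with h | h
      · exact h2 (eq_two_of_dvd_sixteen hq h)
      · have hqd' : (q : ℤ) ∣ d := hqint.dvd_of_dvd_pow h
        exact hqd ((Nat.prime_dvd_prime_iff_eq hq hd).mp (Int.natCast_dvd_natCast.mp hqd')).symm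
    · exact hqm (hqint.dvd_of_dvd_pow h)

/-- Odd multiplicative primes divide the conductor of a twisted Frey model. -/
theorem dvd_conductorNorm_of_twistCovariants (hAB : IsCoprime A B) (h0 : A * B * (A + B) ≠ 0)
    (h16 : ¬ (16 : ℤ) ∣ A * B * (A + B)) (hd : d.Prime) (hd5 : 5 ≤ d)
    (hdM : ¬ (d : ℤ) ∣ A * B * (A + B))
    (hc₄ : W₀.c₄ = 16 * (d : ℤ) ^ 2 * (A ^ 2 + A * B + B ^ 2))
    (hΔ : W₀.Δ = 16 * (d : ℤ) ^ 6 * (A * B * (A + B)) ^ 2)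
    {q : ℕ} (hq : q.Prime) (hq2 : q ≠ 2) (hqm : (q : ℤ) ∣ A * B * (A + B)) :
    q ∣ (W₀.baseChange ℚ).conductorNorm ℤ := by
  haveI := isElliptic_of_twistCovariants h0 hd hΔ
  have hN0 : (W₀.baseChange ℚ).conductorNorm ℤ ≠ 0 := (conductorNorm_pos_holds _).ne'
  have hqd : q ≠ d := by rintro rfl; exact hdM hqm
  obtain ⟨v, hv⟩ := exists_place ⟨q, hq⟩
  simp only at hv
  have hmin := isMinimalAt_of_twistCovariants hAB h0 h16 hd hd5 hdM hc₄ hΔ v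
  have hqint : Prime (q : ℤ) := Nat.prime_iff_prime_int.mp hq
  have h1 : (W₀.baseChange ℚ).conductorExponent v = 1 := by
    refine conductorExponent_eq_one_of_dvd_Δ_of_not_dvd_c₄ hmin ?_ ?_
    · rw [hv, hΔ]
      exact dvd_mul_of_dvd_right (dvd_pow hqm two_ne_zero) _
    · rw [hv, hc₄]
      intro h
      rcases hqint.dvd_or_dvd h with h | h
      · rcases hqint.dvd_or_dvd h with h | h
        · exact hq2 (eq_two_of_dvd_sixteen hq h)
        · have hqd' : (q : ℤ) ∣ d := hqint.dvd_of_dvd_pow h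
          exact hqd ((Nat.prime_dvd_prime_iff_eq hq hd).mp (Int.natCast_dvd_natCast.mp hqd'))
      · exact not_dvd_sq_add_mul_add_sq hAB hq hqm h
  have hfac : ((W₀.baseChange ℚ).conductorNorm ℤ).factorization q = 1 := by
    rw [show q = ((⟨q, hq⟩ : Nat.Primes) : ℕ) from rfl, factorization_conductorNorm_primesEquiv_symm,
      show (primesEquiv (R := ℤ)).symm ⟨q, hq⟩ = v from
        (primesEquiv (R := ℤ)).symm_apply_eq.mpr (Subtype.ext hv.symm)]
    exact h1
  exact (Nat.Prime.dvd_iff_one_le_factorization hq hN0).mpr (by omega)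

/-- The square of the twisting prime divides the conductor (`f_d ≥ 2`, additive reduction). -/
theorem sq_dvd_conductorNorm_of_twistCovariants (hAB : IsCoprime A B) (h0 : A * B * (A + B) ≠ 0)
    (h16 : ¬ (16 : ℤ) ∣ A * B * (A + B)) (hd : d.Prime) (hd5 : 5 ≤ d)
    (hdM : ¬ (d : ℤ) ∣ A * B * (A + B))
    (hc₄ : W₀.c₄ = 16 * (d : ℤ) ^ 2 * (A ^ 2 + A * B + B ^ 2))
    (hΔ : W₀.Δ = 16 * (d : ℤ) ^ 6 * (A * B * (A + B)) ^ 2) :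
    d ^ 2 ∣ (W₀.baseChange ℚ).conductorNorm ℤ := by
  haveI := isElliptic_of_twistCovariants h0 hd hΔ
  have hN0 : (W₀.baseChange ℚ).conductorNorm ℤ ≠ 0 := (conductorNorm_pos_holds _).ne'
  obtain ⟨v, hv⟩ := exists_place ⟨d, hd⟩
  simp only at hv
  have hmin := isMinimalAt_of_twistCovariants hAB h0 h16 hd hd5 hdM hc₄ hΔ v
  have h2 : 2 ≤ (W₀.baseChange ℚ).conductorExponent v := by
    refine two_le_conductorExponent_of_dvd_Δ_of_dvd_c₄ hmin ?_ ?_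
    · rw [hv, hΔ]
      exact dvd_mul_of_dvd_left (dvd_mul_of_dvd_right (dvd_pow_self _ (by norm_num)) _) _
    · rw [hv, hc₄]
      exact dvd_mul_of_dvd_left (dvd_mul_of_dvd_right (dvd_pow_self _ (by norm_num)) _) _
  have hfac : ((W₀.baseChange ℚ).conductorNorm ℤ).factorization d =
      (W₀.baseChange ℚ).conductorExponent v := by
    rw [show d = ((⟨d, hd⟩ : Nat.Primes) : ℕ) from rfl, factorization_conductorNorm_primesEquiv_symm,
      show (primesEquiv (R := ℤ)).symm ⟨d, hd⟩ = v from
        (primesEquiv (R := ℤ)).symm_apply_eq.mpr (Subtype.ext hv.symm)]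
  exact (hd.pow_dvd_iff_le_factorization hN0).mpr (by omega)

end TwistLike

end Summit.ABC.ABC.Theorems.SomeWindowSaving.Negative
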